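import Literature.NumberTheory.PAdicHodge.AinfRamifiedDivisionTransport
import Literature.NumberTheory.PAdicHodge.AinfRamifiedDivisionLift
import Literature.NumberTheory.PAdicHodge.AinfWeierstrassDivisionLift
import Literature.NumberTheory.PAdicHodge.FormalLogSecondKindTransport
import HarnessLib

/-!
# The CM-fibre transport on the Tate module `T_pŴ_D(𝒪_{ℂ_F})` and on Kummer towers: additivity for `⊕_{W_D}`, `Γ_F`-equivariance, depth

Topic `Literature/NumberTheory/PAdicHodge` (theorems only; no definition, no named fact, no instance, no `sorry`). Sequel of
`AinfRamifiedDivisionTransport` (`exists_unique_int_divisionSeq_of_ramified`: every exact `[p]_{W_D}`-tower `v` of `Ŵ_D(𝔪_{ℂ_F})` has a unique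
exact `[p]_{E₀}`-tower `w = T(v)` with `‖wₙ − vₙ‖ ≤ ‖ϖ‖`, for a ramified good model `W_D ≡ E₀ ⊗ 𝒪_D (mod ϖ)`, `E₀/ℤ`). Setting: `D` an Eisenstein
root datum over the `p`-adic field `F` (`𝒪_D = ℤ_p[ϖ] = CoeffDisc D`), `W : WeierstrassCurve (CoeffDisc D)`, `E₀ : WeierstrassCurve ℤ`, and the
bridge `ψ : 𝒪_D → 𝒪_F` (`AinfRamifiedTateModule` §2) through which the Tate module `T_pŴ_D = TatePtO F (W.map ψ) p` is read.

* §1 `norm_ramified_addWC_sub_le` — the chord–tangent laws of two Weierstrass equations congruent modulo `c` differ by a multiple of `c`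
  (tree `FormalLogSecondKindTransport.exists_formalGroupLaw_sub_eq_C_mul_of_map_eq`), hence **`‖(s ⊕_{W₁} t) − (s ⊕_{W₂} t)‖ ≤ ‖c‖`** on
  `Ŵ(𝔪_{ℂ_F})`; `ramified_addWC_map_int`
  (`⊕_{E₀ ⊗ 𝒪_D} = ⊕_{E₀}`), `norm_ramified_addWC_sub_addWC_int_le` (`‖(s ⊕_{W_D} t) − (s ⊕_{E₀} t)‖ ≤ ‖ϖ‖`).
* §2 ★★ `addSeq_int_eq_transport_addSeq` — **the transport is ADDITIVE for `⊕_{W_D}` on the source**: if `w, w'` transport `v, v'`, then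
  `w ⊕_{E₀} w'` transports `v ⊕_{W_D} v'`; `galSeq_eq_transport_galSeq` — **and `Γ_F`-EQUIVARIANT** (`σw` transports `σv`).
* §3 on `τ ∈ T_pŴ_D`: `exists_unique_transport_seqO` (the transport `T(τ)` of the coordinate sequence `seqO τ`), ★ `norm_transport_seqO_zero_le`
  (**depth `‖T(τ)₀‖ ≤ ‖ϖ‖`**, since `τ₀ = 0`) and `norm_transport_seqO_zero_pow_le` (`‖T(τ)₀‖^N ≤ ‖p‖` for `N ≥ e`, `‖ϖ‖^e = ‖p‖` — the depth
  hypothesis of the φ-road's `A_max`-periods at index `N`), `transport_seqO_add` (`T(τ + τ') = T(τ) ⊕_{E₀} T(τ')`), `transport_seqO_smul`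
  (`T(σ • τ) = σT(τ)`), `transport_seqO_zero` (`T(0) = 0`).
* §4 ★★ `addSeq_transport_kummer_eq_galSeq` — for a `[p]_{W_D}`-division tower `u` of a point and `σ ∈ Γ_F`, the transports of the Kummer torsion
  tower `κ_u(σ) = σu ⊖_{W_D} u` (`kummerSeqO`, the coordinate sequence of `kummerCocycleO … σ ∈ T_pŴ_D`) and of `u` satisfy
  **`T(κ_u σ) ⊕_{E₀} T(u) = σ·T(u)`** — the input of the integrating identity `Λ(T κ_u σ) = σΛ(Tu) − Λ(Tu)` in `A_max`.

NOTE: `T(τ)₀ = lim_k [p^k]_{E₀} τ_k` is in general NOT `0` — the transport of a torsion tower of `W_D` is a division tower of a (small) point of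
`Ê₀(𝔪_{ℂ_F})`, to which the φ-road (`BmaxPlusFormalLogDivisionTower`, any `[p]_{E₀}`-division sequence) applies. Purpose: line `kato_lever`, crux
K★ `stmt-BirchSwinnertonDyer-22226`, memo `Lines/kato-lever-K2-ramified-cm-transport.md` §8 step 2 (T2: transported periods on `T_pŴ_D`).
BSD / K★ are not proved by any of this; nothing about elliptic curves over number fields is proved here.

## References
* N. M. Katz, *Crystalline cohomology, Dieudonné modules, and Jacobi sums* (1981), Thm. 5.1.4–5.1.5. [Katz1981CrystallineDieudonne]
* P. Colmez, *Périodes p-adiques des variétés abéliennes*, Math. Ann. 292 (1992), §2. [Colmez1992PeriodesAbeliennes]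
* J. H. Silverman, *The Arithmetic of Elliptic Curves* (2009), IV.2.2–IV.2.3, VIII.§2. [SilvermanAEC2009]
* S. Bloch, K. Kato, *L-functions and Tamagawa numbers of motives* (1990), Ex. 3.10.1. [BlochKato1990]
-/

noncomputable section

open PowerSeries Filter Topology Field WittVector ValuativeRel
open scoped Classical

namespace Literature.NumberTheory.PAdicHodge

open Literature.NumberTheory.GaloisRepresentations Literature.NumberTheory.GaloisRepresentations.IsNonarchimedeanLocalField
open Literature.NumberTheory.GaloisRepresentations.LubinTate Literature.NumberTheory.EllipticCurves

variable {F : Type} [Field F] [ValuativeRel F] [TopologicalSpace F] [IsNonarchimedeanLocalField F] [CharZero F]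
  {p : ℕ} [hpp : Fact p.Prime] {hp : valuation F p < 1} (D : EisensteinRoot F p hp)
  [Fact (¬ IsUnit (p : integerC F))]

/-! ## §1 The chord–tangent laws agree modulo `ϖ` -/

omit [Fact (¬ IsUnit (p : integerC F))] in
/-- ★ **`‖(s ⊕_{W₁} t) − (s ⊕_{W₂} t)‖ ≤ ‖c‖`** on `Ŵ(𝔪_{ℂ_F})` for Weierstrass equations `W₁ ≡ W₂ (mod c)` over `𝒪_D` (the difference of the laws is
`c·G` with `G` integral, whose value at points of `𝔪_ℂ` lies in `𝒪_ℂ`). [cite: SilvermanAEC2009, IV.2.2] [cite: Katz1981CrystallineDieudonne, Thm. 5.1.4] -/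
theorem norm_ramified_addWC_sub_le (c : EisensteinRoot.CoeffDisc D) (W₁ W₂ : WeierstrassCurve (EisensteinRoot.CoeffDisc D))
    (h : W₁.map (Ideal.Quotient.mk (Ideal.span {c})) = W₂.map (Ideal.Quotient.mk (Ideal.span {c}))) (s t : (maxNilIdealC F).toIdeal) :
    ‖(((AinfRamTop.addWC W₁ s t : (maxNilIdealC F).toIdeal) : CBall F) : CompletedAlgClosure F) -
        (((AinfRamTop.addWC W₂ s t : (maxNilIdealC F).toIdeal) : CBall F) : CompletedAlgClosure F)‖ ≤
      ‖((algebraMap (EisensteinRoot.CoeffDisc D) (CBall F) c : CBall F) : CompletedAlgClosure F)‖ := by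
  obtain ⟨G, hG⟩ := exists_formalGroupLaw_sub_eq_C_mul_of_map_eq c W₁ W₂ h
  rw [AinfRamTop.addWC, AinfRamTop.addWC, coe_evalPt, coe_evalPt, ← AddSubgroupClass.coe_sub, ← map_sub, hG, map_mul,
    show (MvPowerSeries.C c : MvPowerSeries (Fin 2) (EisensteinRoot.CoeffDisc D)) = algebraMap _ _ c from rfl, AlgHom.commutes,
    Subring.coe_mul, norm_mul]
  exact mul_le_of_le_one_right (norm_nonneg _)
    ((mem_unitBall_iff _).mp (MvPowerSeries.aeval ((maxNilIdealC F).hasEval ![s, t]) G).2)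

omit [Fact (¬ IsUnit (p : integerC F))] in
/-- The structure maps `ℤ → 𝒪_{ℂ_F}` and `ℤ → 𝒪_D → 𝒪_{ℂ_F}` agree. [folklore] -/
private theorem algebraMap_coeffDisc_algebraMap_int' (a : ℤ) :
    algebraMap (EisensteinRoot.CoeffDisc D) (CBall F) (algebraMap ℤ (EisensteinRoot.CoeffDisc D) a) = algebraMap ℤ (CBall F) a := by
  rw [algebraMap_int_eq, algebraMap_int_eq, eq_intCast, eq_intCast, map_intCast]

omit [Fact (¬ IsUnit (p : integerC F))] in
/-- **`⊕_{E₀ ⊗ 𝒪_D} = ⊕_{E₀}`** on `Ŵ(𝔪_{ℂ_F})`: the ramified-API addition of the base change of `E₀/ℤ` is the φ-road's `AinfTop.addWC F E₀` (change of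
coefficients in the evaluation). [cite: SilvermanAEC2009, IV.2.2] -/
theorem ramified_addWC_map_int (E₀ : WeierstrassCurve ℤ) (s t : (maxNilIdealC F).toIdeal) :
    AinfRamTop.addWC (D := D) (E₀.map (algebraMap ℤ (EisensteinRoot.CoeffDisc D))) s t = AinfTop.addWC F E₀ s t := by
  rw [AinfRamTop.addWC, AinfTop.addWC]
  have key : ∀ (f₁ f₂ : MvPowerSeries (Fin 2) (EisensteinRoot.CoeffDisc D)) (_ : f₁ = f₂) (h₁ : f₁.constantCoeff = 0)
      (h₂ : f₂.constantCoeff = 0), evalPt (maxNilIdealC F) f₁ h₁ ![s, t] = evalPt (maxNilIdealC F) f₂ h₂ ![s, t] := by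
    intro f₁ f₂ e h₁ h₂; subst e; rfl
  have hmap : (MvPowerSeries.map (algebraMap ℤ (EisensteinRoot.CoeffDisc D)) E₀.formalGroupLaw).constantCoeff = 0 := by
    rw [WeierstrassCurve.map_formalGroupLaw]; exact (E₀.map _).constantCoeff_formalGroupLaw
  rw [key _ _ (E₀.map_formalGroupLaw (algebraMap ℤ (EisensteinRoot.CoeffDisc D))).symm _ hmap]
  exact evalPt_map_of_algebraMap_eq (algebraMap ℤ (EisensteinRoot.CoeffDisc D)) (algebraMap_coeffDisc_algebraMap_int' D)
    (maxNilIdealC F) E₀.formalGroupLaw E₀.constantCoeff_formalGroupLaw hmap ![s, t]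

omit [Fact (¬ IsUnit (p : integerC F))] in
/-- ★ **`‖(s ⊕_{W_D} t) − (s ⊕_{E₀} t)‖ ≤ ‖ϖ‖`** on `Ŵ(𝔪_{ℂ_F})` for a ramified model `W_D ≡ E₀ ⊗ 𝒪_D (mod ϖ)`.
[cite: Katz1981CrystallineDieudonne, Thm. 5.1.4] [cite: SilvermanAEC2009, IV.2.2] -/
theorem norm_ramified_addWC_sub_addWC_int_le (W : WeierstrassCurve (EisensteinRoot.CoeffDisc D)) (E₀ : WeierstrassCurve ℤ)
    (hWE : W.map (Ideal.Quotient.mk (Ideal.span {EisensteinRoot.CoeffDisc.of D (AdjoinRoot.root D.poly)})) =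
      (E₀.map (algebraMap ℤ (EisensteinRoot.CoeffDisc D))).map
        (Ideal.Quotient.mk (Ideal.span {EisensteinRoot.CoeffDisc.of D (AdjoinRoot.root D.poly)})))
    (s t : (maxNilIdealC F).toIdeal) :
    ‖(((AinfRamTop.addWC W s t : (maxNilIdealC F).toIdeal) : CBall F) : CompletedAlgClosure F) -
        (((AinfTop.addWC F E₀ s t : (maxNilIdealC F).toIdeal) : CBall F) : CompletedAlgClosure F)‖ ≤
      ‖((D.rootC : integerC F) : CompletedAlgClosure F)‖ := by
  have h1 := norm_ramified_addWC_sub_le D _ W _ hWE s t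
  rw [ramified_addWC_map_int D E₀] at h1
  refine h1.trans (le_of_eq ?_)
  rw [EisensteinRoot.coe_algebraMap_coeffDisc_cBall, EisensteinRoot.Coeff.toF_root, EisensteinRoot.coe_rootC]

/-! ## §2 The transport is additive for `⊕_{W_D}` and `Γ_F`-equivariant -/

section Transport

variable (W : WeierstrassCurve (EisensteinRoot.CoeffDisc D)) (E₀ : WeierstrassCurve ℤ)
  (hWE : W.map (Ideal.Quotient.mk (Ideal.span {EisensteinRoot.CoeffDisc.of D (AdjoinRoot.root D.poly)})) =
    (E₀.map (algebraMap ℤ (EisensteinRoot.CoeffDisc D))).map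
      (Ideal.Quotient.mk (Ideal.span {EisensteinRoot.CoeffDisc.of D (AdjoinRoot.root D.poly)})))

omit [CharZero F] in
/-- Ultrametric chaining of three `ϖ`-bounds. [folklore] -/
private theorem norm_sub_le_of_three {δ : ℝ} (a b c d : CompletedAlgClosure F) (h₁ : ‖a - b‖ ≤ δ) (h₂ : ‖b - c‖ ≤ δ) (h₃ : ‖c - d‖ ≤ δ) :
    ‖a - d‖ ≤ δ := by
  have e : a - d = (a - b) + ((b - c) + (c - d)) := by ring
  rw [e]
  exact (IsUltrametricDist.norm_add_le_max _ _).trans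
    (max_le h₁ ((IsUltrametricDist.norm_add_le_max _ _).trans (max_le h₂ h₃)))

include hWE in
/-- ★★ **The transport is ADDITIVE for `⊕_{W_D}`.** Let `v, v'` be sequences of points of `Ŵ(𝔪_{ℂ_F})`, `w, w'` EXACT `[p]_{E₀}`-towers with
`‖wₙ − vₙ‖, ‖w'ₙ − v'ₙ‖ ≤ ‖ϖ‖`. Then every exact `[p]_{E₀}`-tower `u` with `‖uₙ − (v ⊕_{W_D} v')ₙ‖ ≤ ‖ϖ‖` is `w ⊕_{E₀} w'`: the laws agree modulo
`ϖ` (§1), `⊕_{E₀}` is `1`-Lipschitz, and exact towers are rigid (`AinfTop.mulPC_divisionSeq_unique`, `‖ϖ‖ < 1`).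
[cite: Katz1981CrystallineDieudonne, Thm. 5.1.4–5.1.5] [cite: Colmez1992PeriodesAbeliennes, §2] -/
theorem addSeq_int_eq_transport_addSeq {v v' w w' : ℕ → (maxNilIdealC F).toIdeal}
    (hw : ∀ n, AinfTop.mulPC F p E₀ (w (n + 1)) = w n) (hw' : ∀ n, AinfTop.mulPC F p E₀ (w' (n + 1)) = w' n)
    (hwv : ∀ n, ‖(((w n : (maxNilIdealC F).toIdeal) : CBall F) : CompletedAlgClosure F) -
      (((v n : (maxNilIdealC F).toIdeal) : CBall F) : CompletedAlgClosure F)‖ ≤ ‖((D.rootC : integerC F) : CompletedAlgClosure F)‖)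
    (hw'v' : ∀ n, ‖(((w' n : (maxNilIdealC F).toIdeal) : CBall F) : CompletedAlgClosure F) -
      (((v' n : (maxNilIdealC F).toIdeal) : CBall F) : CompletedAlgClosure F)‖ ≤ ‖((D.rootC : integerC F) : CompletedAlgClosure F)‖)
    (u : ℕ → (maxNilIdealC F).toIdeal) (hu : ∀ n, AinfTop.mulPC F p E₀ (u (n + 1)) = u n)
    (huv : ∀ n, ‖(((u n : (maxNilIdealC F).toIdeal) : CBall F) : CompletedAlgClosure F) -
      (((AinfRamTop.addSeq W v v' n : (maxNilIdealC F).toIdeal) : CBall F) : CompletedAlgClosure F)‖ ≤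
        ‖((D.rootC : integerC F) : CompletedAlgClosure F)‖) :
    u = AinfTop.addSeq F E₀ w w' := by
  refine AinfTop.mulPC_divisionSeq_unique E₀ D.norm_rootC_lt_one u (AinfTop.addSeq F E₀ w w') hu (AinfTop.mulPC_addSeq E₀ hw hw')
    fun n => norm_sub_le_of_three _ (((AinfRamTop.addSeq W v v' n : (maxNilIdealC F).toIdeal) : CBall F) : CompletedAlgClosure F)
      (((AinfTop.addSeq F E₀ v v' n : (maxNilIdealC F).toIdeal) : CBall F) : CompletedAlgClosure F) _ (huv n) ?_ ?_
  · rw [AinfRamTop.addSeq]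
    exact norm_ramified_addWC_sub_addWC_int_le D W E₀ hWE (v n) (v' n)
  · rw [AinfTop.addSeq, ← norm_neg, neg_sub]
    exact (AinfTop.norm_addWC_sub_addWC_le E₀ _ _ _ _).trans (max_le (hwv n) (hw'v' n))

/-- **The transport is `Γ_F`-EQUIVARIANT**: if `w` transports `v`, then `σw` is the transport of `σv` (`Γ_F` acts isometrically and preserves
exactness). This is `AinfTop.galSeq_eq_of_divisionSeq_norm_sub_le` at `δ = ‖ϖ‖`. [cite: FontaineAsterisque223III, Exp. II §1.2]
[cite: Colmez1992PeriodesAbeliennes, §2] -/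
theorem galSeq_eq_transport_galSeq [IsAdicComplete (Ideal.span {(p : integerC F)}) (integerC F)]
    (hθ : Function.Surjective (fontaineTheta (integerC F) p)) (σ : absoluteGaloisGroup F) {v w : ℕ → (maxNilIdealC F).toIdeal}
    (hw : ∀ n, AinfTop.mulPC F p E₀ (w (n + 1)) = w n)
    (hwv : ∀ n, ‖(((w n : (maxNilIdealC F).toIdeal) : CBall F) : CompletedAlgClosure F) -
      (((v n : (maxNilIdealC F).toIdeal) : CBall F) : CompletedAlgClosure F)‖ ≤ ‖((D.rootC : integerC F) : CompletedAlgClosure F)‖)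
    (w' : ℕ → (maxNilIdealC F).toIdeal) (hw' : ∀ n, AinfTop.mulPC F p E₀ (w' (n + 1)) = w' n)
    (hw'v : ∀ n, ‖(((w' n : (maxNilIdealC F).toIdeal) : CBall F) : CompletedAlgClosure F) -
      (((AinfTop.galSeq F σ v n : (maxNilIdealC F).toIdeal) : CBall F) : CompletedAlgClosure F)‖ ≤
        ‖((D.rootC : integerC F) : CompletedAlgClosure F)‖) :
    w' = AinfTop.galSeq F σ w :=
  AinfTop.galSeq_eq_of_divisionSeq_norm_sub_le E₀ hθ σ D.norm_rootC_lt_one hw hwv w' hw' hw'v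

/-- **Transport of an exact `[p]_{E₀}`-tower is the tower itself** (`T` fixes exact towers). [cite: Colmez1992PeriodesAbeliennes, §2] -/
theorem eq_of_transport_of_exact {v w : ℕ → (maxNilIdealC F).toIdeal} (hv : ∀ n, AinfTop.mulPC F p E₀ (v (n + 1)) = v n)
    (hw : ∀ n, AinfTop.mulPC F p E₀ (w (n + 1)) = w n)
    (hwv : ∀ n, ‖(((w n : (maxNilIdealC F).toIdeal) : CBall F) : CompletedAlgClosure F) -
      (((v n : (maxNilIdealC F).toIdeal) : CBall F) : CompletedAlgClosure F)‖ ≤ ‖((D.rootC : integerC F) : CompletedAlgClosure F)‖) :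
    w = v :=
  AinfTop.eq_of_divisionSeq_norm_sub_le_of_exact E₀ D.norm_rootC_lt_one hv hw hwv

/-! ## §3 The transport on `T_pŴ_D = TatePtO F (W.map ψ) p` -/

variable (ψ : EisensteinRoot.CoeffDisc D →+* LTCoeff F) (hψ : ∀ c, algebraMap (LTCoeff F) F (ψ c) = EisensteinRoot.CoeffDisc.toF D c)

include hWE hψ in
/-- ★ **The transport `T(τ)` of `τ ∈ T_pŴ_D`**: the coordinate sequence `seqO τ` is an exact `[p]_{W_D}`-tower (`AinfRamTop.mulPC_seqO`), hence has a
UNIQUE exact `[p]_{E₀}`-tower at distance `≤ ‖ϖ‖`. [cite: Katz1981CrystallineDieudonne, Thm. 5.1.4–5.1.5] [cite: Colmez1992PeriodesAbeliennes, §2] -/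
theorem exists_unique_transport_seqO (τ : AinfTop.TatePtO F (W.map ψ) p) :
    ∃! w : ℕ → (maxNilIdealC F).toIdeal, (∀ n, AinfTop.mulPC F p E₀ (w (n + 1)) = w n) ∧
      ∀ n, ‖(((w n : (maxNilIdealC F).toIdeal) : CBall F) : CompletedAlgClosure F) -
        (((AinfTop.seqO (W.map ψ) τ n : (maxNilIdealC F).toIdeal) : CBall F) : CompletedAlgClosure F)‖ ≤
          ‖((D.rootC : integerC F) : CompletedAlgClosure F)‖ :=
  exists_unique_int_divisionSeq_of_ramified D W E₀ hWE (AinfRamTop.mulPC_seqO W ψ hψ τ)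

omit [Fact (¬ IsUnit (p : integerC F))] in
/-- ★ **Depth of the transport: `‖T(τ)₀‖ ≤ ‖ϖ‖`** (`τ₀ = 0`, `AinfTop.seqO_zero`). [cite: Colmez1992PeriodesAbeliennes, §2] -/
theorem norm_transport_seqO_zero_le (τ : AinfTop.TatePtO F (W.map ψ) p) {w : ℕ → (maxNilIdealC F).toIdeal}
    (hwv : ∀ n, ‖(((w n : (maxNilIdealC F).toIdeal) : CBall F) : CompletedAlgClosure F) -
      (((AinfTop.seqO (W.map ψ) τ n : (maxNilIdealC F).toIdeal) : CBall F) : CompletedAlgClosure F)‖ ≤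
        ‖((D.rootC : integerC F) : CompletedAlgClosure F)‖) :
    ‖(((w 0 : (maxNilIdealC F).toIdeal) : CBall F) : CompletedAlgClosure F)‖ ≤ ‖((D.rootC : integerC F) : CompletedAlgClosure F)‖ := by
  have h := hwv 0
  rwa [AinfTop.seqO_zero, ZeroMemClass.coe_zero, sub_zero] at h

omit [Fact (¬ IsUnit (p : integerC F))] in
/-- ★ **`‖T(τ)₀‖^N ≤ ‖p‖` for `N ≥ e`** (`‖ϖ‖^e = ‖p‖`, `EisensteinRoot.norm_rootC_pow`): the transported towers of `T_pŴ_D` are deep enough for the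
φ-road's `A_max`-periods at index `N` (`BmaxPlusFormalLogDivisionTower`, hypothesis `‖u₀‖^N ≤ ‖p‖`). [cite: SerreLocalFields1979, Ch. I §6 Prop. 17]
[cite: Colmez1992PeriodesAbeliennes, §2] -/
theorem norm_transport_seqO_zero_pow_le (τ : AinfTop.TatePtO F (W.map ψ) p) {w : ℕ → (maxNilIdealC F).toIdeal}
    (hwv : ∀ n, ‖(((w n : (maxNilIdealC F).toIdeal) : CBall F) : CompletedAlgClosure F) -
      (((AinfTop.seqO (W.map ψ) τ n : (maxNilIdealC F).toIdeal) : CBall F) : CompletedAlgClosure F)‖ ≤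
        ‖((D.rootC : integerC F) : CompletedAlgClosure F)‖) {N : ℕ} (hN : D.e ≤ N) :
    ‖(((w 0 : (maxNilIdealC F).toIdeal) : CBall F) : CompletedAlgClosure F)‖ ^ N ≤ ‖(p : CompletedAlgClosure F)‖ := by
  have h0 := norm_transport_seqO_zero_le D W ψ τ hwv
  have hϖ1 : ‖((D.rootC : integerC F) : CompletedAlgClosure F)‖ ≤ 1 := D.norm_rootC_lt_one.le
  calc ‖(((w 0 : (maxNilIdealC F).toIdeal) : CBall F) : CompletedAlgClosure F)‖ ^ N
      ≤ ‖((D.rootC : integerC F) : CompletedAlgClosure F)‖ ^ N := pow_le_pow_left₀ (norm_nonneg _) h0 N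
    _ ≤ ‖((D.rootC : integerC F) : CompletedAlgClosure F)‖ ^ D.e := pow_le_pow_of_le_one (norm_nonneg _) hϖ1 hN
    _ = ‖(p : CompletedAlgClosure F)‖ := D.norm_rootC_pow

include hWE hψ in
/-- ★ **`T(τ + τ') = T(τ) ⊕_{E₀} T(τ')`**: the transport of a sum in `T_pŴ_D` is the `E₀`-sum of the transports (`seqO (τ + τ')` is the termwise
`⊕_{W_D}`-sum, `AinfRamTop.seqO_add_eq_addSeq`; §2). [cite: Katz1981CrystallineDieudonne, Thm. 5.1.5] [cite: SilvermanAEC2009, IV.2.3] -/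
theorem transport_seqO_add (τ τ' : AinfTop.TatePtO F (W.map ψ) p) {w w' u : ℕ → (maxNilIdealC F).toIdeal}
    (hw : ∀ n, AinfTop.mulPC F p E₀ (w (n + 1)) = w n) (hw' : ∀ n, AinfTop.mulPC F p E₀ (w' (n + 1)) = w' n)
    (hwv : ∀ n, ‖(((w n : (maxNilIdealC F).toIdeal) : CBall F) : CompletedAlgClosure F) -
      (((AinfTop.seqO (W.map ψ) τ n : (maxNilIdealC F).toIdeal) : CBall F) : CompletedAlgClosure F)‖ ≤
        ‖((D.rootC : integerC F) : CompletedAlgClosure F)‖)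
    (hw'v : ∀ n, ‖(((w' n : (maxNilIdealC F).toIdeal) : CBall F) : CompletedAlgClosure F) -
      (((AinfTop.seqO (W.map ψ) τ' n : (maxNilIdealC F).toIdeal) : CBall F) : CompletedAlgClosure F)‖ ≤
        ‖((D.rootC : integerC F) : CompletedAlgClosure F)‖)
    (hu : ∀ n, AinfTop.mulPC F p E₀ (u (n + 1)) = u n)
    (huv : ∀ n, ‖(((u n : (maxNilIdealC F).toIdeal) : CBall F) : CompletedAlgClosure F) -
      (((AinfTop.seqO (W.map ψ) (τ + τ') n : (maxNilIdealC F).toIdeal) : CBall F) : CompletedAlgClosure F)‖ ≤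
        ‖((D.rootC : integerC F) : CompletedAlgClosure F)‖) :
    u = AinfTop.addSeq F E₀ w w' := by
  refine addSeq_int_eq_transport_addSeq D W E₀ hWE hw hw' hwv hw'v u hu fun n => ?_
  rw [← AinfRamTop.seqO_add_eq_addSeq W ψ hψ]
  exact huv n

/-- ★ **`T(σ • τ) = σ·T(τ)`** (`seqO (σ • τ) = σ ∘ seqO τ`, `AinfTop.seqO_smul`; §2). [cite: FontaineAsterisque223III, Exp. II §1.2] -/
theorem transport_seqO_smul [IsAdicComplete (Ideal.span {(p : integerC F)}) (integerC F)]
    (hθ : Function.Surjective (fontaineTheta (integerC F) p)) (σ : absoluteGaloisGroup F) (τ : AinfTop.TatePtO F (W.map ψ) p)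
    {w w' : ℕ → (maxNilIdealC F).toIdeal} (hw : ∀ n, AinfTop.mulPC F p E₀ (w (n + 1)) = w n)
    (hwv : ∀ n, ‖(((w n : (maxNilIdealC F).toIdeal) : CBall F) : CompletedAlgClosure F) -
      (((AinfTop.seqO (W.map ψ) τ n : (maxNilIdealC F).toIdeal) : CBall F) : CompletedAlgClosure F)‖ ≤
        ‖((D.rootC : integerC F) : CompletedAlgClosure F)‖)
    (hw' : ∀ n, AinfTop.mulPC F p E₀ (w' (n + 1)) = w' n)
    (hw'v : ∀ n, ‖(((w' n : (maxNilIdealC F).toIdeal) : CBall F) : CompletedAlgClosure F) -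
      (((AinfTop.seqO (W.map ψ) (σ • τ) n : (maxNilIdealC F).toIdeal) : CBall F) : CompletedAlgClosure F)‖ ≤
        ‖((D.rootC : integerC F) : CompletedAlgClosure F)‖) :
    w' = AinfTop.galSeq F σ w :=
  galSeq_eq_transport_galSeq D E₀ hθ σ hw hwv w' hw' (by simpa only [AinfTop.seqO_smul] using hw'v)

/-- **`T(0) = 0`**: the transport of `0 ∈ T_pŴ_D` is the zero tower (which is exact for `E₀` and at distance `0`).
[cite: Colmez1992PeriodesAbeliennes, §2] -/
theorem transport_seqO_zero {w : ℕ → (maxNilIdealC F).toIdeal} (hw : ∀ n, AinfTop.mulPC F p E₀ (w (n + 1)) = w n)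
    (hwv : ∀ n, ‖(((w n : (maxNilIdealC F).toIdeal) : CBall F) : CompletedAlgClosure F) -
      (((AinfTop.seqO (W.map ψ) (0 : AinfTop.TatePtO F (W.map ψ) p) n : (maxNilIdealC F).toIdeal) : CBall F) : CompletedAlgClosure F)‖ ≤
        ‖((D.rootC : integerC F) : CompletedAlgClosure F)‖) :
    w = 0 := by
  refine eq_of_transport_of_exact D E₀ (v := 0) (AinfTop.mulPC_zeroSeq E₀) hw fun n => ?_
  have h0 : AinfTop.seqO (W.map ψ) (0 : AinfTop.TatePtO F (W.map ψ) p) n = 0 := by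
    rw [AinfTop.seqO_apply, map_zero, WeierstrassCurve.Pt.val_zero]
  have h := hwv n
  rwa [h0] at h

/-! ## §4 Kummer towers: `T(κ_u σ) ⊕_{E₀} T(u) = σ·T(u)` -/

include hψ in
omit [Fact (¬ IsUnit (p : integerC F))] in
/-- `κ_u(σ) ⊕_{W_D} u = σu` termwise (`(σP − P) + P = σP` in the group `Ŵ♭(𝔪_{ℂ_F})`, `W♭ = W ⊗_ψ 𝒪_F`). [cite: SilvermanAEC2009, VIII.§2] -/
theorem addSeq_kummerSeqO_self (σ : absoluteGaloisGroup F) (u : ℕ → (maxNilIdealC F).toIdeal) :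
    AinfRamTop.addSeq W (AinfRamTop.kummerSeqO W ψ σ u) u = AinfTop.galSeq F σ u := by
  funext n
  rw [AinfRamTop.addSeq, AinfRamTop.kummerSeqO, ← AinfRamTop.val_add_map_ψ W ψ hψ, sub_add_cancel]
  rfl

include hWE hψ in
/-- ★★ **`T(κ_u σ) ⊕_{E₀} T(u) = σ·T(u)`.** Let `u` be a `[p]_{W_D}`-division tower of points of `Ŵ_D(𝔪_{ℂ_F})` (`u₀` arbitrary), `Tu` its transport
and `Tκ` the transport of the Kummer torsion tower `κ_u(σ)ₙ = σuₙ ⊖_{W_D} uₙ` (`kummerSeqO`; for `Γ_F`-fixed `u₀` this is the coordinate sequence of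
`kummerCocycleO … σ ∈ T_pŴ_D`). Then `Tκ ⊕_{E₀} Tu` is exact and `ϖ`-close to `κ_u(σ) ⊕_{W_D} u = σu`, as is `σ·Tu`; by rigidity they coincide.
(So `T(κ_u σ)` is the `E₀`-Kummer tower of `Tu` for `σ` — whose base point `σ(Tu)₀ ⊖ (Tu)₀` need not vanish.)
[cite: BlochKato1990, Ex. 3.10.1] [cite: Katz1981CrystallineDieudonne, Thm. 5.1.5] [cite: Colmez1992PeriodesAbeliennes, §2] -/
theorem addSeq_transport_kummer_eq_galSeq [IsAdicComplete (Ideal.span {(p : integerC F)}) (integerC F)]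
    (hθ : Function.Surjective (fontaineTheta (integerC F) p)) (σ : absoluteGaloisGroup F)
    {u Tu Tκ : ℕ → (maxNilIdealC F).toIdeal}
    (hTu : ∀ n, AinfTop.mulPC F p E₀ (Tu (n + 1)) = Tu n)
    (hTuv : ∀ n, ‖(((Tu n : (maxNilIdealC F).toIdeal) : CBall F) : CompletedAlgClosure F) -
      (((u n : (maxNilIdealC F).toIdeal) : CBall F) : CompletedAlgClosure F)‖ ≤ ‖((D.rootC : integerC F) : CompletedAlgClosure F)‖)
    (hTκ : ∀ n, AinfTop.mulPC F p E₀ (Tκ (n + 1)) = Tκ n)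
    (hTκv : ∀ n, ‖(((Tκ n : (maxNilIdealC F).toIdeal) : CBall F) : CompletedAlgClosure F) -
      (((AinfRamTop.kummerSeqO W ψ σ u n : (maxNilIdealC F).toIdeal) : CBall F) : CompletedAlgClosure F)‖ ≤
        ‖((D.rootC : integerC F) : CompletedAlgClosure F)‖) :
    AinfTop.addSeq F E₀ Tκ Tu = AinfTop.galSeq F σ Tu := by
  -- `σ·Tu` is the transport of `σu = κ ⊕_{W_D} u`; so is `Tκ ⊕_{E₀} Tu`
  refine (addSeq_int_eq_transport_addSeq D W E₀ hWE hTκ hTu hTκv hTuv (AinfTop.galSeq F σ Tu) (AinfTop.mulPC_galSeq E₀ hθ σ hTu)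
    fun n => ?_).symm
  rw [addSeq_kummerSeqO_self D W ψ hψ σ u, AinfTop.norm_galSeq_sub_galSeq_eq]
  exact hTuv n

end Transport

end Literature.NumberTheory.PAdicHodge
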